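import Summits.BirchSwinnertonDyer.BirchSwinnertonDyer.Theorems.ResidualThetaTransportAtTwoThetaLayerLambdaCongruenceAtTwoCuspSpanPrimePowTools
import Summits.BirchSwinnertonDyer.BirchSwinnertonDyer.Theorems.ResidualThetaTransportAtTwoThetaLayerLambdaCongruenceAtTwoCuspSpanAuxPrimePow
import Mathlib.NumberTheory.LSeries.PrimesInAP
import HarnessLib

/-!
# Route `ResidualThetaTransportAtTwo`, node 27436 (cruxes Kan⁺ stmt-BirchSwinnertonDyer-20688 / Kμ⁺ 20689 / 21437): the `q`-ADIC TRIANGLE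
# RULE at PRIME-POWER level `p^E` — `F(−q) = F(u) + F(−q/u)` for ADMISSIBLE odd primes `q` and GOOD units `u`

Cell `bsd-wall`, width seat `bsd-wall-rtt-p3-w2` g4 (2026-08-28). THEOREMS ONLY; `--supports stmt-BirchSwinnertonDyer-20688`; BSD is not
proved by this. Sequel to `…CuspSpanRuleQ` (prime level). At level `p^E` the 4-invariance is not available a priori; the construction is
rearranged so that the exponent `k` in `(gβ'β₃)₁₁ = −4^k` is a multiple of `φ(p^E)` (then `4^k ≡ 1 (mod p^E)` and the any-level triangle
lemma `…PrimePowTools.chi_add_chi_eq_of_triangle_of_cast_pow_eq_one` applies). This needs the ODD Hensel period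
`P = ((q−1)/2)·q^{t−1}` of `4` modulo `q^t` to be prime to `φ(p^E)`: ADMISSIBLE `q` means `gcd((q−1)/2, p(p−1)) = 1` and `q ∤ p − 1`
(so `q ≡ 3 (mod 4)`, `q ≢ 1 (mod p)`). GOOD `u` means `(q−1)/u ≢ 1 (mod p)` (then the auxiliary prime `n ≡ (q−1)/u (mod p^E)` has
`(n−1)/2` prime to `φ(p^E)` and the exponent `t ≡ 1 (mod φ(p^E))` with `(n−1)/2 ∣ t` exists). The sequel `…CuspSpanPrimePowLevel`
removes GOOD by the symmetry `u ↔ −q/u` and multiplies admissible primes up to the node at every odd prime power `p^E`, `p ≥ 5`.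

* `chi_b1_rule_primePow` — for `b = −1` elements `β_w, β_u, β_v` of `Γ₀(p^E)` with `d(β_w) ≡ −q`, `d(β_v)d(β_u) ≡ d(β_w)`, `q` admissible,
  `u` good: `χ β_w = χ β_u + χ β_v`.

References: P. G. L. Dirichlet (1837) / Mathlib `PrimesInAP`; L. Euler (totient theorem) / Mathlib `Nat.ModEq.pow_totient`;
[Rademacher1929] §1; [Knapp1993] Prop. 11.1; [Pollack2003] Conj. 6.3.
-/

set_option autoImplicit false
set_option linter.dupNamespace false

open scoped MatrixGroups

open CongruenceSubgroup

namespace Summit.BirchSwinnertonDyer.BirchSwinnertonDyer.Theorems.SignedMuAtTwo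

section PrimePowLevel

variable {p E : ℕ} [Fact p.Prime] [NeZero (p ^ E)] {χ : Gamma0 (p ^ E) → ZMod 2}

omit [Fact p.Prime] [NeZero (p ^ E)] in
/-- `IsCoprime d (p^E)` for an integer whose class mod `p^E` is a unit. [folklore] -/
theorem isCoprime_int_of_isUnit_cast {d : ℤ} (hd : IsUnit ((d : ℤ) : ZMod (p ^ E))) : IsCoprime d ((p ^ E : ℕ) : ℤ) :=
  ((ZMod.coe_int_isUnit_iff_isCoprime d (p ^ E)).mp hd).symm

/-- **The `q`-adic triangle rule at prime-power level.** `p` odd prime, `E ≥ 1`, `q` an admissible prime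
(`gcd((q−1)/2, p(p−1)) = 1`, `q ∤ p−1`, `q ≠ p`), `β_w, β_u, β_v` `b = −1` elements of `Γ₀(p^E)` with `d(β_w) ≡ −q`, `d(β_v)d(β_u) ≡ d(β_w)`,
and `u = d̄(β_u)` good (`((q−1)u⁻¹) mod p ≠ 1`): `χ β_w = χ β_u + χ β_v`. [cite: Rademacher1929, §1] [cite: Pollack2003, Conj. 6.3] -/
theorem chi_b1_rule_primePow (hp2 : p ≠ 2) (hE : 1 ≤ E)
    (hadd : ∀ γ δ : Gamma0 (p ^ E), χ (γ * δ) = χ γ + χ δ)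
    (hsmall : ∀ γ : Gamma0 (p ^ E), ((γ : SL(2, ℤ)) 0 0 + (γ : SL(2, ℤ)) 1 1).natAbs ≤ 2 → χ γ = 0)
    (hkill : ∀ γ : Gamma0 (p ^ E), (∃ k : ℕ, 1 ≤ k ∧ ((γ : SL(2, ℤ)) 1 1).natAbs = 4 ^ k) → χ γ = 0)
    (q : ℕ) (hq : q.Prime) (hqp : q ≠ p) (hadm : Nat.Coprime (q / 2) (p * (p - 1))) (hqp1 : ¬ q ∣ p - 1)
    {βw βu βv : Gamma0 (p ^ E)} (hbw : (βw : SL(2, ℤ)) 0 1 = -1) (hbu : (βu : SL(2, ℤ)) 0 1 = -1)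
    (hbv : (βv : SL(2, ℤ)) 0 1 = -1)
    (hw : ((((βw : SL(2, ℤ)) 1 1 : ℤ) : ZMod (p ^ E))) = -(q : ZMod (p ^ E)))
    (hv : ((((βv : SL(2, ℤ)) 1 1 : ℤ) : ZMod (p ^ E))) * ((((βu : SL(2, ℤ)) 1 1 : ℤ) : ZMod (p ^ E))) =
      ((((βw : SL(2, ℤ)) 1 1 : ℤ) : ZMod (p ^ E))))
    (hgood : (((q : ZMod (p ^ E)) - 1) * ((((βu : SL(2, ℤ)) 1 1 : ℤ) : ZMod (p ^ E)))⁻¹).val % p ≠ 1) :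
    χ βw = χ βu + χ βv := by
  have hp : p.Prime := Fact.out
  have hp3 : 3 ≤ p := by
    have := hp.two_le; rcases Nat.lt_or_ge 2 p with h | h
    · omega
    · exfalso; exact hp2 (le_antisymm h hp.two_le)
  -- admissibility consequences: `q` odd, `p ∤ q − 1`
  have hpodd : p % 2 = 1 := Nat.odd_iff.mp (hp.eq_two_or_odd'.resolve_left hp2)
  have hq2 : q ≠ 2 := by
    rintro rfl
    exact hqp1 (Nat.dvd_of_mod_eq_zero (by omega))
  have hq3 : 3 ≤ q := by have := hq.two_le; omega
  have hqodd : q % 2 = 1 := Nat.odd_iff.mp (hq.eq_two_or_odd'.resolve_left hq2)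
  have hpq1 : ¬ p ∣ q - 1 := by
    intro h
    have h2 : q - 1 = 2 * (q / 2) := by omega
    rw [h2] at h
    have hp2' : ¬ p ∣ 2 := fun h' ↦ hp2 ((Nat.prime_dvd_prime_iff_eq hp Nat.prime_two).mp h')
    have : p ∣ q / 2 := (Nat.Prime.dvd_mul hp).mp h |>.resolve_left hp2'
    have hg : p ∣ Nat.gcd (q / 2) (p * (p - 1)) := Nat.dvd_gcd this (dvd_mul_right _ _)
    rw [hadm] at hg
    exact hp.one_lt.ne' (Nat.dvd_one.mp hg)
  -- units: `U = d̄(β_u)`, `q̄`, `q̄ − 1`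
  set U : ZMod (p ^ E) := ((((βu : SL(2, ℤ)) 1 1 : ℤ) : ZMod (p ^ E))) with hUdef
  set V : ZMod (p ^ E) := ((((βv : SL(2, ℤ)) 1 1 : ℤ) : ZMod (p ^ E))) with hVdef
  have hUu : IsUnit U := isUnit_gamma0_apply_one_one βu
  have hVu : IsUnit V := isUnit_gamma0_apply_one_one βv
  have hUinv : U * U⁻¹ = 1 := ZMod.mul_inv_of_unit U hUu
  have hcopq : Nat.Coprime q (p ^ E) := Nat.Coprime.pow_right _ ((Nat.coprime_primes hq hp).mpr hqp)
  have hqu : IsUnit (q : ZMod (p ^ E)) := (ZMod.isUnit_iff_coprime q (p ^ E)).mpr hcopq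
  have hq1u : IsUnit ((q : ZMod (p ^ E)) - 1) := by
    have h1 : (((q - 1 : ℕ)) : ZMod (p ^ E)) = (q : ZMod (p ^ E)) - 1 := by
      rw [Nat.cast_sub (by omega)]; simp
    rw [← h1, ZMod.isUnit_iff_coprime]
    exact Nat.Coprime.pow_right _ ((Nat.coprime_comm.mp ((Nat.Prime.coprime_iff_not_dvd hp).mpr hpq1)))
  set n₀ : ZMod (p ^ E) := ((q : ZMod (p ^ E)) - 1) * U⁻¹ with hn₀
  have hn₀u : IsUnit n₀ := by
    have hUi : IsUnit U⁻¹ := IsUnit.of_mul_eq_one U (by rw [mul_comm, hUinv])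
    exact hq1u.mul hUi
  have ha₀p : ¬ p ∣ n₀.val := by
    intro h
    have hc : Nat.Coprime n₀.val (p ^ E) := by
      have := ZMod.val_coe_unit_coprime hn₀u.unit
      rwa [IsUnit.unit_spec] at this
    have : p ∣ Nat.gcd n₀.val (p ^ E) := Nat.dvd_gcd h (dvd_pow_self p (by omega))
    rw [hc] at this
    exact hp.one_lt.ne' (Nat.dvd_one.mp this)
  -- Hensel exponent and the auxiliary prime
  obtain ⟨e, he1, -, hens⟩ := exists_hensel_four q hq hq2
  obtain ⟨n, hnprime, hpn, hqn, hna, hqe, hn4, hcop, hqh⟩ :=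
    exists_aux_prime_pow p q hp hq hp2 hq2 (Ne.symm hqp) hE he1 n₀.val ha₀p hgood
  have hncast : (n : ZMod (p ^ E)) = n₀ := by
    rw [(ZMod.natCast_eq_natCast_iff _ _ _).mpr hna, ZMod.natCast_zmod_val]
  have hh1 : 1 ≤ n / 2 := by omega
  -- `Φ = φ(p^E)` and Euler
  set Φ : ℕ := p ^ (E - 1) * (p - 1) with hΦ
  have hΦ1 : 1 ≤ Φ := Nat.one_le_iff_ne_zero.mpr (Nat.mul_ne_zero (pow_ne_zero _ hp.ne_zero) (by omega))
  have htot : Nat.totient (p ^ E) = Φ := by rw [hΦ, Nat.totient_prime_pow hp (by omega)]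
  have hEuler : ∀ a : ℕ, Nat.Coprime a (p ^ E) → (a : ZMod (p ^ E)) ^ Φ = 1 := by
    intro a ha
    have h1 := Nat.ModEq.pow_totient ha
    rw [htot] at h1
    have h2 := (ZMod.natCast_eq_natCast_iff _ _ _).mpr h1
    push_cast at h2
    exact h2
  have hqΦ : (q : ZMod (p ^ E)) ^ Φ = 1 := hEuler q hcopq
  have hFermat : ∀ m : ℕ, (q : ZMod (p ^ E)) ^ m = (q : ZMod (p ^ E)) ^ (m % Φ) := fun m ↦ by
    conv_lhs => rw [← Nat.div_add_mod m Φ, pow_add, pow_mul, hqΦ, one_pow, one_mul]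
  -- the exponent `t`: `(n−1)/2 ∣ t`, `t ≡ 1 (mod Φ)`, `t ≥ 1`
  obtain ⟨x₀, hx₀h, hx₀s⟩ := Nat.chineseRemainder hcop 0 1
  obtain ⟨t, ht⟩ : ∃ t, t = x₀ + (n / 2) * Φ := ⟨_, rfl⟩
  have ht1 : 1 ≤ t := by
    have : 1 ≤ (n / 2) * Φ := Nat.one_le_iff_ne_zero.mpr (Nat.mul_ne_zero (by omega) (by omega))
    omega
  have hht : n / 2 ∣ t := by
    have : n / 2 ∣ x₀ := Nat.modEq_zero_iff_dvd.mp hx₀h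
    rw [ht]; exact dvd_add this (dvd_mul_right _ _)
  have hts : t % Φ = 1 % Φ := by
    have e1 : t ≡ x₀ [MOD Φ] := ((Nat.modEq_iff_dvd' (by omega)).mpr (by rw [ht]; simp)).symm
    exact e1.trans hx₀s
  -- `q^t ≡ 1 (mod n)` and `q^t ≡ q (mod p^E)`
  have hqtn : (n : ℤ) ∣ (q : ℤ) ^ t - 1 := by
    obtain ⟨l, hl⟩ := hht
    rw [← ZMod.intCast_zmod_eq_zero_iff_dvd]
    push_cast
    rw [hl, pow_mul, hqh, one_pow, sub_self]
  have hqtp : (q : ZMod (p ^ E)) ^ t = (q : ZMod (p ^ E)) := by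
    rw [hFermat t, hts, ← hFermat 1, pow_one]
  obtain ⟨d, hd⟩ := hqtn
  -- `d ≡ u (mod p^E)`
  have hdU : ((d : ℤ) : ZMod (p ^ E)) = U := by
    have e1 := congrArg (Int.cast : ℤ → ZMod (p ^ E)) hd
    push_cast at e1
    rw [hqtp, hncast, hn₀] at e1
    -- `e1 : q − 1 = (q−1) U⁻¹ d`
    have e3 : ((q : ZMod (p ^ E)) - 1) * (U⁻¹ * ((d : ℤ) : ZMod (p ^ E))) = ((q : ZMod (p ^ E)) - 1) * 1 := by
      rw [mul_one]; linear_combination -e1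
    have e4 := hq1u.mul_left_cancel e3
    calc ((d : ℤ) : ZMod (p ^ E)) = U * (U⁻¹ * ((d : ℤ) : ZMod (p ^ E))) := by rw [← mul_assoc, hUinv, one_mul]
      _ = U := by rw [e4, mul_one]
  have hcd : IsCoprime d ((p ^ E : ℕ) : ℤ) := isCoprime_int_of_isUnit_cast (by rw [hdU]; exact hUu)
  obtain ⟨a, κ, hak⟩ := hcd
  obtain ⟨g, hg00, hg01, hg10, hg11⟩ := ThetaLayerLambdaCongruenceAtTwo.exists_gamma0_entries (N := p ^ E)
    a (-1) ((p ^ E : ℕ) * κ) d (by linear_combination hak) (dvd_mul_right _ _)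
  have hpE : ((p : ZMod (p ^ E))) ^ E = 0 := by rw [← Nat.cast_pow]; exact ZMod.natCast_self _
  have haU : ((a : ℤ) : ZMod (p ^ E)) * U = 1 := by
    have e1 := congrArg (Int.cast : ℤ → ZMod (p ^ E)) hak
    push_cast at e1
    rw [hpE, mul_zero, add_zero, hdU] at e1
    exact e1
  have ha' : ((a : ℤ) : ZMod (p ^ E)) = U⁻¹ := by
    calc ((a : ℤ) : ZMod (p ^ E)) = ((a : ℤ) : ZMod (p ^ E)) * (U * U⁻¹) := by rw [hUinv, mul_one]
      _ = U⁻¹ := by rw [← mul_assoc, haU, one_mul]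
  -- `d' := −n − a ≡ −q/u = v`
  obtain ⟨d', hd'⟩ : ∃ d' : ℤ, d' = -(n : ℤ) - a := ⟨_, rfl⟩
  have hV' : V = -(q : ZMod (p ^ E)) * U⁻¹ := by
    have e1 : V * U = -(q : ZMod (p ^ E)) := by rw [hVdef, hUdef, hv, hw]
    calc V = V * (U * U⁻¹) := by rw [hUinv, mul_one]
      _ = -(q : ZMod (p ^ E)) * U⁻¹ := by rw [← mul_assoc, e1]
  have hd'V : ((d' : ℤ) : ZMod (p ^ E)) = V := by
    rw [hd', hV']
    push_cast
    rw [hncast, hn₀, ha']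
    ring
  have hcd' : IsCoprime d' ((p ^ E : ℕ) : ℤ) := isCoprime_int_of_isUnit_cast (by rw [hd'V]; exact hVu)
  obtain ⟨α', κ', hak'⟩ := hcd'
  obtain ⟨β', -, hb01, -, hb11⟩ := ThetaLayerLambdaCongruenceAtTwo.exists_gamma0_entries (N := p ^ E)
    α' (-1) ((p ^ E : ℕ) * κ') d' (by linear_combination hak') (dvd_mul_right _ _)
  -- entries of `g β'`: upper-right `n`, lower-right `−q^t`
  obtain ⟨hB, hD⟩ := b1_mul_b1_entries (N := p ^ E) hg01 hb01
  rw [hg00, hb11, hd'] at hB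
  rw [hg10, hg11, hb11, hd'] at hD
  have hB' : ((g * β' : Gamma0 (p ^ E)) : SL(2, ℤ)) 0 1 = n := by rw [hB]; ring
  have hD' : ((g * β' : Gamma0 (p ^ E)) : SL(2, ℤ)) 1 1 = -(q : ℤ) ^ t := by
    rw [hD]; linear_combination hd - hak
  -- the lower-left entry `c₂`
  obtain ⟨c₂, hc₂⟩ : ∃ c₂ : ℤ, c₂ = ((g * β' : Gamma0 (p ^ E)) : SL(2, ℤ)) 1 0 := ⟨_, rfl⟩
  have hdet := Matrix.SpecialLinearGroup.det_coe ((g * β' : Gamma0 (p ^ E)) : SL(2, ℤ))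
  rw [Matrix.det_fin_two, hB', hD', ← hc₂] at hdet
  have hqen : (q : ℤ) ^ e ∣ (n : ℤ) + 1 := by exact_mod_cast hqe
  obtain ⟨ν, hν⟩ := hqen
  have hc₂1 : (q : ℤ) ^ (min e t) ∣ c₂ - 1 := by
    have e1 : c₂ - 1 = ((g * β' : Gamma0 (p ^ E)) : SL(2, ℤ)) 0 0 * (q : ℤ) ^ t + (q : ℤ) ^ e * (ν * c₂) := by
      linear_combination hdet + c₂ * hν
    rw [e1]
    exact dvd_add (dvd_mul_of_dvd_right (pow_dvd_pow _ (min_le_right _ _)) _)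
      (dvd_mul_of_dvd_left (pow_dvd_pow _ (min_le_left _ _)) _)
  obtain ⟨k₀, hk₀1, hk₀⟩ := hens t c₂ hc₂1
  -- the period `P := (q/2) q^{t−1}`, prime to `Φ`; exponent `k ≡ k₀ (mod P)`, `Φ ∣ k`
  set P : ℕ := (q / 2) * q ^ (t - 1) with hP
  have hPdvd : (q : ℤ) ^ t ∣ 4 ^ P - 1 := by
    have := prime_pow_dvd_four_pow_half_mul_sub_one q hq hq2 (t - 1)
    rwa [show t - 1 + 1 = t by omega] at this
  have hcopP : Nat.Coprime P Φ := by
    have hΦdvd : Φ ∣ (p * (p - 1)) ^ E := by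
      obtain ⟨E', hE'⟩ : ∃ E', E = E' + 1 := ⟨E - 1, by omega⟩
      refine ⟨p * (p - 1) ^ E', ?_⟩
      rw [hΦ, hE', Nat.add_sub_cancel]; ring
    have h1 : Nat.Coprime (q / 2) Φ := Nat.Coprime.coprime_dvd_right hΦdvd (hadm.pow_right E)
    have hqp' : Nat.Coprime q (p * (p - 1)) :=
      Nat.Coprime.mul_right ((Nat.coprime_primes hq hp).mpr hqp) ((Nat.Prime.coprime_iff_not_dvd hq).mpr hqp1)
    have h2 : Nat.Coprime (q ^ (t - 1)) Φ := Nat.Coprime.coprime_dvd_right hΦdvd ((hqp'.pow_right E).pow_left _)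
    exact Nat.Coprime.mul_left h1 h2
  obtain ⟨k', hk'P, hk'Φ⟩ := Nat.chineseRemainder hcopP k₀ 0
  obtain ⟨k, hk⟩ : ∃ k, k = k' + k₀ * (P * Φ) := ⟨_, rfl⟩
  have hPΦ1 : 1 ≤ P * Φ := Nat.one_le_iff_ne_zero.mpr (Nat.mul_ne_zero
    (Nat.mul_ne_zero (by omega) (pow_ne_zero _ hq.ne_zero)) (by omega))
  have hkk₀ : k₀ ≤ k := by
    have : k₀ * 1 ≤ k₀ * (P * Φ) := Nat.mul_le_mul_left _ hPΦ1
    omega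
  have hk1 : 1 ≤ k := le_trans hk₀1 hkk₀
  have hkP : k ≡ k₀ [MOD P] := by
    have h0 : k₀ * (P * Φ) ≡ 0 [MOD P] := Nat.modEq_zero_iff_dvd.mpr ⟨k₀ * Φ, by ring⟩
    have := hk'P.add h0
    rw [add_zero] at this
    rw [hk]; exact this
  have hkΦ : Φ ∣ k := by
    rw [hk]
    exact dvd_add (Nat.modEq_zero_iff_dvd.mp hk'Φ) ⟨k₀ * P, by ring⟩
  -- `q^t ∣ 4^k − c₂`
  have hkc : (q : ℤ) ^ t ∣ 4 ^ k - c₂ := by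
    obtain ⟨m, hm⟩ := (Nat.modEq_iff_dvd' hkk₀).mp hkP.symm
    have hkm : k = k₀ + P * m := by omega
    have h1 : Int.ModEq ((q : ℤ) ^ t) ((4 : ℤ) ^ P) 1 := (Int.modEq_iff_dvd.mpr hPdvd).symm
    have h2 : Int.ModEq ((q : ℤ) ^ t) ((4 : ℤ) ^ k) (4 ^ k₀) := by
      rw [hkm, pow_add, pow_mul]
      have := (h1.pow m).mul_left ((4 : ℤ) ^ k₀)
      simpa using this
    have h3 : Int.ModEq ((q : ℤ) ^ t) ((4 : ℤ) ^ k₀) c₂ :=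
      (Int.modEq_iff_dvd.mpr (by simpa using hk₀)).symm
    exact (h2.trans h3).symm.dvd
  -- `4^k ≡ 1 (mod p^E)`
  have h4k : ((p ^ E : ℕ) : ℤ) ∣ 4 ^ k - 1 := by
    obtain ⟨m, hm⟩ := hkΦ
    have hc4 : Nat.Coprime 4 (p ^ E) := by
      have : Nat.Coprime 2 p := (Nat.coprime_primes Nat.prime_two hp).mpr (Ne.symm hp2)
      simpa using (this.pow_left 2).pow_right E
    have h1 : ((4 : ℕ) : ZMod (p ^ E)) ^ Φ = 1 := hEuler 4 hc4
    rw [← ZMod.intCast_zmod_eq_zero_iff_dvd]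
    push_cast
    rw [hm, pow_mul]
    push_cast at h1
    rw [h1, one_pow, sub_self]
  have hdvd : ((g * β' : Gamma0 (p ^ E)) : SL(2, ℤ)) 1 1 ∣ ((g * β' : Gamma0 (p ^ E)) : SL(2, ℤ)) 1 0 - 4 ^ k := by
    rw [hD', ← hc₂, neg_dvd]
    have : c₂ - 4 ^ k = -(4 ^ k - c₂) := by ring
    rw [this, dvd_neg]; exact hkc
  -- the triangle identity with `β₃ := βw`
  have hres : ((((βw : SL(2, ℤ)) 1 1 : ℤ) : ZMod (p ^ E))) =
      ((((g * β' : Gamma0 (p ^ E)) : SL(2, ℤ)) 1 1 : ℤ) : ZMod (p ^ E)) := by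
    rw [hw, hD', Int.cast_neg, Int.cast_pow, Int.cast_natCast, hqtp]
  have htri := chi_add_chi_eq_of_triangle_of_cast_pow_eq_one hadd hsmall hkill g β' k hk1 h4k hdvd hbw hres
  have hgu : χ g = χ βu := chi_eq_of_apply_zero_one_eq_neg_one hadd hsmall hg01 hbu (by rw [hg11, hdU])
  have hbv' : χ β' = χ βv := chi_eq_of_apply_zero_one_eq_neg_one hadd hsmall hb01 hbv (by rw [hb11, hd'V])
  rw [← htri, hgu, hbv']

end PrimePowLevel

end Summit.BirchSwinnertonDyer.BirchSwinnertonDyer.Theorems.SignedMuAtTwo
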